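import Summits.QuantumFields.YangMills.Theorems.SwapVirialDeficitLaplaceAbelianLimit
import HarnessLib

/-!
# `G_σ = sigmaMax²` versus the SUM OF SQUARES of the twelve relation norms: `Σ‖rel‖² ≤ 12·G_σ` and `G_σ ≤ Σ‖rel‖²`; hence `e^{−βG_σ} ≤ e^{−(β∕12)Σ‖rel‖²}`
# (free-hands support of ⟨stmt-QuantumFields-24197⟩ `SwapVirialDeficit.SwapGluedStiffness`; cell ym-idea-1, LEAD g98 memo6 §2 ∕ 19:13Z (ii): the core bound's first step —
# turns the max-relation Gibbs factor of ✓`lintegral_hubTip_exp_neg_sigmaMaxSq_le` into an explicit sum-of-squares Gaussian, no small-ball volumes needed upstairs)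

`sigmaMax C` (✓`SwapVirialDeficitLaplaceAbelianLimit`) is `max (⨆_{(μ,ν) ∈ Fin 3²} ‖C_μC_ν − C_νC_μ‖) (⨆_{μ ∈ Fin 3} ‖c·C_{σμ} − C_μ·c‖)` (`c = C 3`, `σ = swap 0 1`;
the diagonal `μ = ν` terms vanish and `(μ,ν)`, `(ν,μ)` repeat — twelve norms in all).  Here, with the SAME twelve terms:
* `commNorm_le_sigmaMax`, `sigmaNorm_le_sigmaMax` (each relation norm is `≤ sigmaMax`);
* ★ `sum_relNormSq_le_twelve_sigmaMaxSq : Σ_{(μ,ν)}‖[C_μ,C_ν]‖² + Σ_μ‖c·C_{σμ} − C_μ·c‖² ≤ 12·sigmaMaxSq C`;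
* ★ `sigmaMaxSq_le_sum_relNormSq : sigmaMaxSq C ≤ Σ_{(μ,ν)}‖[C_μ,C_ν]‖² + Σ_μ‖c·C_{σμ} − C_μ·c‖²`;
* ★★ `exp_neg_sigmaMaxSq_le_exp_neg_sum (hβ : 0 ≤ β) : e^{−β·sigmaMaxSq C} ≤ e^{−(β∕12)·(Σ‖rel‖²)}` and the converse `exp_neg_sum_le_exp_neg_sigmaMaxSq`.

HONEST LABEL: elementary (max vs. sum over a finite family); the core bound itself, all region laws, ⟨24197⟩ ∕ ⟨24194⟩ OPEN; own crux ⟨22884⟩ OPEN (blocked-on ⟨19935⟩);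
the Yang–Mills mass gap is NOT proved; no summit is proved by a line.  THEOREMS ONLY (0 `def`, 0 `sorry`), standard axioms.  Width seat ym-line-sfw-p2-w2 g59
(cell ym-idea-1, free hands), `--supports stmt-QuantumFields-24197`.  References: [folklore].
-/

set_option autoImplicit false

noncomputable section

open Quaternion Literature.MathematicalPhysics.QuantumLattice
open scoped Quaternion BigOperators

namespace Summit.QuantumFields.YangMills.Theorems.SwapVirialDeficit.Abelian

/-- Each commutator norm is `≤ sigmaMax`. [folklore] -/
theorem commNorm_le_sigmaMax (C : Fin 4 → Matrix.specialUnitaryGroup (Fin 2) ℂ) (p : Fin 3 × Fin 3) :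
    ‖su2Quat (C p.1.castSucc) * su2Quat (C p.2.castSucc) - su2Quat (C p.2.castSucc) * su2Quat (C p.1.castSucc)‖ ≤ sigmaMax C := by
  unfold sigmaMax
  refine le_trans ?_ (le_max_left _ _)
  exact le_ciSup (f := fun p : Fin 3 × Fin 3 => ‖su2Quat (C p.1.castSucc) * su2Quat (C p.2.castSucc) - su2Quat (C p.2.castSucc) * su2Quat (C p.1.castSucc)‖)
    (Finite.bddAbove_range _) p

/-- Each σ-relation norm is `≤ sigmaMax`. [folklore] -/
theorem sigmaNorm_le_sigmaMax (C : Fin 4 → Matrix.specialUnitaryGroup (Fin 2) ℂ) (μ : Fin 3) :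
    ‖su2Quat (C (Fin.last 3)) * su2Quat (C (Equiv.swap (0 : Fin 3) 1 μ).castSucc) - su2Quat (C μ.castSucc) * su2Quat (C (Fin.last 3))‖ ≤ sigmaMax C := by
  unfold sigmaMax
  refine le_trans ?_ (le_max_right _ _)
  exact le_ciSup (f := fun μ : Fin 3 => ‖su2Quat (C (Fin.last 3)) * su2Quat (C (Equiv.swap (0 : Fin 3) 1 μ).castSucc) - su2Quat (C μ.castSucc) * su2Quat (C (Fin.last 3))‖)
    (Finite.bddAbove_range _) μ

/-- ★ **Sum of squares ≤ 12 · max²**. [folklore] -/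
theorem sum_relNormSq_le_twelve_sigmaMaxSq (C : Fin 4 → Matrix.specialUnitaryGroup (Fin 2) ℂ) :
    (∑ p : Fin 3 × Fin 3, ‖su2Quat (C p.1.castSucc) * su2Quat (C p.2.castSucc) - su2Quat (C p.2.castSucc) * su2Quat (C p.1.castSucc)‖ ^ 2) +
        ∑ μ : Fin 3, ‖su2Quat (C (Fin.last 3)) * su2Quat (C (Equiv.swap (0 : Fin 3) 1 μ).castSucc) - su2Quat (C μ.castSucc) * su2Quat (C (Fin.last 3))‖ ^ 2 ≤
      12 * sigmaMaxSq C := by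
  have h1 : ∑ p : Fin 3 × Fin 3, ‖su2Quat (C p.1.castSucc) * su2Quat (C p.2.castSucc) - su2Quat (C p.2.castSucc) * su2Quat (C p.1.castSucc)‖ ^ 2 ≤
      ∑ _p : Fin 3 × Fin 3, sigmaMax C ^ 2 :=
    Finset.sum_le_sum fun p _ => pow_le_pow_left₀ (norm_nonneg _) (commNorm_le_sigmaMax C p) 2
  have h2 : ∑ μ : Fin 3, ‖su2Quat (C (Fin.last 3)) * su2Quat (C (Equiv.swap (0 : Fin 3) 1 μ).castSucc) - su2Quat (C μ.castSucc) * su2Quat (C (Fin.last 3))‖ ^ 2 ≤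
      ∑ _μ : Fin 3, sigmaMax C ^ 2 :=
    Finset.sum_le_sum fun μ _ => pow_le_pow_left₀ (norm_nonneg _) (sigmaNorm_le_sigmaMax C μ) 2
  rw [Finset.sum_const, Finset.card_univ, Fintype.card_prod, Fintype.card_fin] at h1
  rw [Finset.sum_const, Finset.card_univ, Fintype.card_fin] at h2
  simp only [nsmul_eq_mul, Nat.cast_ofNat, Nat.cast_mul] at h1 h2
  unfold sigmaMaxSq
  linarith

/-- ★ **max² ≤ sum of squares**. [folklore] -/
theorem sigmaMaxSq_le_sum_relNormSq (C : Fin 4 → Matrix.specialUnitaryGroup (Fin 2) ℂ) :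
    sigmaMaxSq C ≤
      (∑ p : Fin 3 × Fin 3, ‖su2Quat (C p.1.castSucc) * su2Quat (C p.2.castSucc) - su2Quat (C p.2.castSucc) * su2Quat (C p.1.castSucc)‖ ^ 2) +
        ∑ μ : Fin 3, ‖su2Quat (C (Fin.last 3)) * su2Quat (C (Equiv.swap (0 : Fin 3) 1 μ).castSucc) - su2Quat (C μ.castSucc) * su2Quat (C (Fin.last 3))‖ ^ 2 := by
  have hS1 : 0 ≤ ∑ p : Fin 3 × Fin 3, ‖su2Quat (C p.1.castSucc) * su2Quat (C p.2.castSucc) - su2Quat (C p.2.castSucc) * su2Quat (C p.1.castSucc)‖ ^ 2 :=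
    Finset.sum_nonneg fun p _ => by positivity
  have hS2 : 0 ≤ ∑ μ : Fin 3, ‖su2Quat (C (Fin.last 3)) * su2Quat (C (Equiv.swap (0 : Fin 3) 1 μ).castSucc) - su2Quat (C μ.castSucc) * su2Quat (C (Fin.last 3))‖ ^ 2 :=
    Finset.sum_nonneg fun μ _ => by positivity
  unfold sigmaMaxSq sigmaMax
  -- the max is attained in one of the two families; each `⨆` over a finite nonempty index set is attained
  rcases le_total (⨆ p : Fin 3 × Fin 3, ‖su2Quat (C p.1.castSucc) * su2Quat (C p.2.castSucc) - su2Quat (C p.2.castSucc) * su2Quat (C p.1.castSucc)‖)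
      (⨆ μ : Fin 3, ‖su2Quat (C (Fin.last 3)) * su2Quat (C (Equiv.swap (0 : Fin 3) 1 μ).castSucc) - su2Quat (C μ.castSucc) * su2Quat (C (Fin.last 3))‖) with h | h
  · rw [max_eq_right h]
    obtain ⟨μ, hμ⟩ := exists_eq_ciSup_of_finite
      (f := fun μ : Fin 3 => ‖su2Quat (C (Fin.last 3)) * su2Quat (C (Equiv.swap (0 : Fin 3) 1 μ).castSucc) - su2Quat (C μ.castSucc) * su2Quat (C (Fin.last 3))‖)
    rw [← hμ]
    have hle := Finset.single_le_sum
      (f := fun μ : Fin 3 => ‖su2Quat (C (Fin.last 3)) * su2Quat (C (Equiv.swap (0 : Fin 3) 1 μ).castSucc) - su2Quat (C μ.castSucc) * su2Quat (C (Fin.last 3))‖ ^ 2)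
      (fun μ _ => by positivity) (Finset.mem_univ μ)
    linarith
  · rw [max_eq_left h]
    obtain ⟨p, hp⟩ := exists_eq_ciSup_of_finite
      (f := fun p : Fin 3 × Fin 3 => ‖su2Quat (C p.1.castSucc) * su2Quat (C p.2.castSucc) - su2Quat (C p.2.castSucc) * su2Quat (C p.1.castSucc)‖)
    rw [← hp]
    have hle := Finset.single_le_sum
      (f := fun p : Fin 3 × Fin 3 => ‖su2Quat (C p.1.castSucc) * su2Quat (C p.2.castSucc) - su2Quat (C p.2.castSucc) * su2Quat (C p.1.castSucc)‖ ^ 2)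
      (fun p _ => by positivity) (Finset.mem_univ p)
    linarith

/-- ★★ **The max-relation Gibbs factor is below the sum-of-squares Gaussian at rate `β∕12`**: `e^{−β·G_σ(C)} ≤ e^{−(β∕12)·Σ‖rel‖²}` (`β ≥ 0`). [folklore] -/
theorem exp_neg_sigmaMaxSq_le_exp_neg_sum {β : ℝ} (hβ : 0 ≤ β) (C : Fin 4 → Matrix.specialUnitaryGroup (Fin 2) ℂ) :
    Real.exp (-(β * sigmaMaxSq C)) ≤
      Real.exp (-(β / 12 * ((∑ p : Fin 3 × Fin 3, ‖su2Quat (C p.1.castSucc) * su2Quat (C p.2.castSucc) - su2Quat (C p.2.castSucc) * su2Quat (C p.1.castSucc)‖ ^ 2) +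
        ∑ μ : Fin 3, ‖su2Quat (C (Fin.last 3)) * su2Quat (C (Equiv.swap (0 : Fin 3) 1 μ).castSucc) - su2Quat (C μ.castSucc) * su2Quat (C (Fin.last 3))‖ ^ 2))) := by
  rw [Real.exp_le_exp, neg_le_neg_iff]
  have h := sum_relNormSq_le_twelve_sigmaMaxSq C
  have := mul_le_mul_of_nonneg_left h (div_nonneg hβ (by norm_num : (0 : ℝ) ≤ 12))
  linarith

/-- ★ **… and above the sum-of-squares Gaussian at rate `β`**: `e^{−β·Σ‖rel‖²} ≤ e^{−β·G_σ(C)}` (`β ≥ 0`). [folklore] -/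
theorem exp_neg_sum_le_exp_neg_sigmaMaxSq {β : ℝ} (hβ : 0 ≤ β) (C : Fin 4 → Matrix.specialUnitaryGroup (Fin 2) ℂ) :
    Real.exp (-(β * ((∑ p : Fin 3 × Fin 3, ‖su2Quat (C p.1.castSucc) * su2Quat (C p.2.castSucc) - su2Quat (C p.2.castSucc) * su2Quat (C p.1.castSucc)‖ ^ 2) +
        ∑ μ : Fin 3, ‖su2Quat (C (Fin.last 3)) * su2Quat (C (Equiv.swap (0 : Fin 3) 1 μ).castSucc) - su2Quat (C μ.castSucc) * su2Quat (C (Fin.last 3))‖ ^ 2))) ≤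
      Real.exp (-(β * sigmaMaxSq C)) := by
  rw [Real.exp_le_exp, neg_le_neg_iff]
  exact mul_le_mul_of_nonneg_left (sigmaMaxSq_le_sum_relNormSq C) hβ

end Summit.QuantumFields.YangMills.Theorems.SwapVirialDeficit.Abelian

end
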